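import Summits.MatrixMultiplication.OmegaCensus.SmallFormats.MatMul22nRankGF3ThirtySixElevenths
import HarnessLib

/-!
# ω-census family (a): the kernel window for `R_𝔽₃(⟨2,2,n⟩)` — `max(3n+2, ⌈36n/11⌉) ≤ R ≤ ⌈7n/2⌉`

Cell `pub-omega` (unit `pub-omega-tensor-g6`), topic `Summits/MatrixMultiplication/OmegaCensus`
(sub-folder `SmallFormats`). Framing (verbatim): lottery ticket; floor = certified bounds/negative ranges.
HONEST FRAMING: bookkeeping only — one citable declaration per census cell combining the tree's kernel floors
over `𝔽₃` (`3n+2` for `n ≥ 4`: `MatMul22nRankGF3ThreeNPlusTwo`; `⌈36n/11⌉`: `MatMul22nRankGF3ThirtySixElevenths`,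
Nazarov's printed value) with the Hopcroft–Kerr ceiling `⌈7n/2⌉` (any ring). The floor equals print for every `n`;
the windows below are what remains OPEN over `𝔽₃` (width `⌈7n/2⌉ − max(3n+2, ⌈36n/11⌉)`). Not progress on `ω`.
-/

namespace Summit.MatrixMultiplication.OmegaCensus.SmallFormats

open Literature.Computability.AlgebraicComplexity

/-- **Kernel window over `𝔽₃`**: `max(3n+2, ⌈36n/11⌉) ≤ R_𝔽₃(⟨2,2,n⟩) ≤ ⌈7n/2⌉` for every `n ≥ 4`. -/
theorem tensorRank_matMulTensor_22n_gf3_window (n : ℕ) (hn : 4 ≤ n) :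
    max (3 * n + 2) ((36 * n + 10) / 11) ≤ tensorRank (matMulTensor (ZMod 3) 2 2 n) ∧
      tensorRank (matMulTensor (ZMod 3) 2 2 n) ≤ (7 * n + 1) / 2 := by
  refine ⟨max_le (three_mul_add_two_le_tensorRank_matMulTensor_22n_gf3 n hn) ?_,
    hopcroftKerr1971_tensorRank_matMulTensor_22n_le (K := ZMod 3) n⟩
  have h := thirtysix_mul_le_eleven_mul_tensorRank_matMulTensor_22n_gf3 n
  omega

/-- The open cells `n = 5 … 12` over `𝔽₃` as explicit windows:
`[17,18], [20,21], [23,25], [27,28], [30,32], [33,35], [36,39], [40,42]`. -/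
theorem tensorRank_matMulTensor_22n_gf3_windows_5_12 :
    tensorRank (matMulTensor (ZMod 3) 2 2 5) ∈ Set.Icc 17 18 ∧
    tensorRank (matMulTensor (ZMod 3) 2 2 6) ∈ Set.Icc 20 21 ∧
    tensorRank (matMulTensor (ZMod 3) 2 2 7) ∈ Set.Icc 23 25 ∧
    tensorRank (matMulTensor (ZMod 3) 2 2 8) ∈ Set.Icc 27 28 ∧
    tensorRank (matMulTensor (ZMod 3) 2 2 9) ∈ Set.Icc 30 32 ∧
    tensorRank (matMulTensor (ZMod 3) 2 2 10) ∈ Set.Icc 33 35 ∧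
    tensorRank (matMulTensor (ZMod 3) 2 2 11) ∈ Set.Icc 36 39 ∧
    tensorRank (matMulTensor (ZMod 3) 2 2 12) ∈ Set.Icc 40 42 := by
  have w := fun n (hn : 4 ≤ n) => tensorRank_matMulTensor_22n_gf3_window n hn
  have w5 := w 5 (by norm_num); have w6 := w 6 (by norm_num); have w7 := w 7 (by norm_num)
  have w8 := w 8 (by norm_num); have w9 := w 9 (by norm_num); have w10 := w 10 (by norm_num)
  have w11 := w 11 (by norm_num); have w12 := w 12 (by norm_num)
  simp only [Set.mem_Icc, max_le_iff] at *
  omega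

end Summit.MatrixMultiplication.OmegaCensus.SmallFormats
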